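import Literature.AlgebraicGeometry.HodgeTheory.FermatSurfaceNeronSeveriEigenlinesProofs
import Literature.AlgebraicGeometry.HodgeTheory.DiagonalSymmetryStability
import Literature.AlgebraicGeometry.HodgeTheory.HodgeTypeConjugation
import Literature.AlgebraicGeometry.HodgeTheory.ComplexGysinHodgeType
import Literature.AlgebraicGeometry.HodgeTheory.ComplexConjugationHolds
import Literature.AlgebraicGeometry.HodgeTheory.HypersurfaceHodgePQAssembly
import HarnessLib

/-!
# The character decomposition of `Hᵏ(Xⁿₘ(ℂ); ℂ)` is compatible with the Hodge decomposition and with complex conjugation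

Family `hodge`, layer `Literature/AlgebraicGeometry/HodgeTheory`. PROOF FILE (everything here is
PROVED; no named fact is introduced, D-0026), continuing `FermatSurfaceNeronSeveriEigenlinesProofs`
(the reduction of the named fact `AokiShioda1983_eigenline_le_neronSeveri` — Aoki–Shioda 1983,
§2 `(2.1)`: the Hodge eigenlines `V(α)`, `α ∈ 𝔅²ₘ`, of the Fermat surface are algebraic — to
Lefschetz `(1,1)` (L) and the Hodge types of the eigenlines (H)).

Shioda, Proc. Japan Acad. 55A (1979), §4 (text read): "`G` acts on `Xⁿₘ` … and the decomposition
`Hⁿ_prim(Xⁿₘ, ℂ) = ⨁ V(α)` … is compatible with the Hodge decomposition"; Ran, Compositio Math.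
42 (1980), §1 Prop. 1.7 (text read, numdam p. 125): "(i) `Hⁿ(X, ℂ)` decomposes under `G` into
1-dimensional eigenspaces … (ii) the eigenspace of `χ` lies in `H^{p,q}` … (iii) complex
conjugation takes the `χ`-eigenspace to the `χ⁻¹`-eigenspace" (and Shioda, Math. Ann. 245 (1979),
(1.7): `conj V(α) = V(-α)`). On the tree's real carriers — the diagonal symmetries
`g_a : [x] ↦ [a • x]` of a hypersurface `X_F = V₊(F) ⊂ ℙⁿ⁺¹_ℂ` (`DiagonalSymmetry`), the eigenspaces
`V_χ = diagonalCharacterEigenspace F G χ k` of a finite group `G` of them with isotypic projectors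
`π_χ = eigenProjector` (`DiagonalCharacterEigenspace`), Hodge models `A : HodgeModel n X_F` with
their pieces `A.hodgePQ k p q` (`RationalHodgeClasses`) and complex conjugation `conjClass`
(`ComplexConjugation`) — this file PROVES the formal part of these statements:

* `exists_sum_eigenspace_hodgePQ_eq` — **the `(p,q)`-components of an eigenclass are
  eigenclasses**: every `c ∈ V_χ` is `Σ_{p+q=k} c_{p,q}` with `c_{p,q} ∈ V_χ` AND
  `A^* c_{p,q} ∈ H^{p,q}_A`, in EVERY Hodge model `A` of the smooth projective `X_F`. Proof:
  decompose `c` (`HodgeModel.exists_sum_eq_of_hodgeDecomposition`) and apply `π_χ`, which fixes `c`,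
  lands in `V_χ`, and preserves the `(p,q)`-classes of the fixed model `A`
  (`HodgeModel.pullback_eigenProjector_mem_hodgePQ`: the `g_a` are holomorphic on `X^an`,
  Serre GAGA §2 n°5). Hence the criterion `pullback_mem_hodgePQ_of_eigenspace`: if `V_χ` has no
  non-zero class of any type `(p,q) ≠ (p₀,q₀)`, then `V_χ` is of type `(p₀,q₀)`.
* `conjClass_mem_diagonalCharacterEigenspace` — **`conj V_χ ⊆ V_{χ⁻¹}`** (`conj` commutes with
  the `g_a^*`, `conjClass_map`, and is conjugate-linear; the values of `χ` are roots of unity, so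
  `conj χ(a) = χ(a)⁻¹`); for the Fermat variety `conj V(α) ⊆ V(-α)`
  (`conjClass_mem_fermatEigenspace`, with `χ_{-α} = χ_α⁻¹`, `fermatCharacter_neg`). With the
  Hodge symmetry of every Hodge model (`HodgeModel.isHodgeSymmetric`, Voisin I Cor. 6.12, proved
  in the tree): **`V_χ` has no non-zero class of type `(q,p)` as soon as `V_{χ⁻¹}` has none of
  type `(p,q)`** (`eigenspace_eq_zero_of_hodgePQ_swap`).
* `pullback_mem_hodgePQ_half_of_eigenspace` — in even degree `k = 2p`: if neither `V_χ` nor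
  `V_{χ⁻¹}` contains a non-zero class of a type `(p',q')` with `q' < p'`, then `V_χ` is of type
  `(p,p)`; for the FERMAT SURFACE `X²ₘ` (`fermatEigenspace_two_mem_hodgePQ_one_one`): if neither
  `V(β)` nor `V(-β)` contains a non-zero class of type `(2,0)`, then `V(β) ⊆ H^{1,1}`.

Consequence for the named fact (`AokiShioda1983_eigenline_le_neronSeveri_of_lefschetzOneOne_of_twoZero`):
hypothesis (H) of `AokiShioda1983_eigenline_le_neronSeveri_of_lefschetzOneOne` — "`V(β) ⊆ H^{1,1}`
for `β ∈ 𝔅²ₘ`", Shioda (1.7) / Ran Prop. 1.7 (ii) for `n = 2` — is reduced to its `(2,0)`-part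
(H₂₀): **no non-zero class in a Hodge eigenline `V(β)`, `β ∈ 𝔅²ₘ`, is of Hodge type `(2,0)`**
(`𝔅²ₘ` is stable under `β ↦ -β`, `FermatCharacter.IsHodge.neg`; Hodge models exist,
`nonempty_hodgeModel_holds`). In print (H₂₀) is the statement that the holomorphic `2`-forms of
`X²ₘ` — Griffiths residues `Res(x^a Ω/F)`, `Σ aᵢ = m - 4`, of characters `(a₀+1, …, a₃+1)`, all of
length `|·| = 1` — have no component on the characters of length `2` (Shioda (1.7): in the
tree's convention `g_a^* ξ = χ_β(a) ξ`, `g_a : [x] ↦ [a • x]`, the eigenline `V(β)` is of type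
`(2,0)` iff `|β| = 1` and of type `(0,2)` iff `|β| = 3`); it is NOT proved here (it needs
`H⁰(X²ₘ, Ω²) = {Res(PΩ/F) : deg P = m - 4}`, Griffiths 1969 §8 / Voisin II Thm. 6.5 with Serre's
GAGA, or an equivalent upper bound on the holomorphic `2`-forms, not in the tree). The last section
pushes (H₂₀) down to FORMS (`AokiShioda1983_eigenline_le_neronSeveri_of_lefschetzOneOne_of_eigenforms`):
a `(2,0)`-class of `V(β)` is the class of a `χ_β`-EIGENFORM (a closed `(2,0)`-form `η` on the Hodge
model with `(g_a^an)^* η = χ_β(a) η`; `pullback_anMap_eq_smul_of_eigenclass`, because a non-zero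
closed `(2,0)`-form on a compact complex surface is not exact, `closedForm_top_zero_not_exact`).
So the residual obligations of `AokiShioda1983_eigenline_le_neronSeveri_holds` are now:
`lefschetzOneOne_rational` (L) and (H₂₀-forms): for `β ∈ 𝔅²ₘ`, `X²ₘ^an` carries no non-zero
`χ_β`-eigen closed `(2,0)`-form.

## References

* [Shioda1979PJA] T. Shioda, The Hodge conjecture and the Tate conjecture for Fermat varieties,
  Proc. Japan Acad. 55A (1979) 111–114, §4 (text read).
* [Shioda1979HodgeFermat] T. Shioda, The Hodge conjecture for Fermat varieties, Math. Ann. 245 (1979)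
  175–184, §1 (1.7) and Thm. I (cite-only).
* [Ran1980] Z. Ran, Cycles on Fermat hypersurfaces, Compositio Math. 42 (1980) 121–142, §1
  Prop. 1.7 (i)–(iii) (p. 125) (text read, numdam).
* [AokiShioda1983] N. Aoki, T. Shioda, Generators of the Néron–Severi group of a Fermat surface, in:
  Arithmetic and Geometry I, Progr. Math. 35, Birkhäuser (1983) 1–12, §2 `(2.1)` (text read).
* [VoisinHodgeI2002] C. Voisin, Hodge Theory and Complex Algebraic Geometry I, CUP 2002, §6.1.3
  Cor. 6.12 (Hodge symmetry), §7.3.2 (functoriality of the Hodge decomposition).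
* [Griffiths1969] P. Griffiths, On the periods of certain rational integrals I, Ann. of Math. 90
  (1969), §8 (cite-only).
-/

noncomputable section

open CategoryTheory AlgebraicGeometry MvPolynomial Finset
open scoped Manifold ContDiff

namespace Literature.AlgebraicGeometry.HodgeTheory

open Literature.AlgebraicGeometry.Motives Literature.AlgebraicTopology.SingularHomology
  Literature.NumberTheory.Transcendental

/-! ### The eigenspaces of a group of diagonal symmetries and the Hodge decomposition -/

section Diagonal

variable {n : ℕ} (F : MvPolynomial (Fin (n + 2)) ℂ) {G : Subgroup (Fin (n + 2) → ℂˣ)}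

/-- **The `(p,q)`-components of an eigenclass are eigenclasses** (Shioda: "the decomposition
`⊕ V(α)` is compatible with the Hodge decomposition"): for `X_F` smooth projective of dimension
`n`, a Hodge model `A` of `X_F` and `c ∈ V_χ ⊆ Hᵏ(X_F(ℂ); ℂ)`, there are classes `c_{p,q}`,
`p + q = k`, with `Σ c_{p,q} = c`, each `c_{p,q} ∈ V_χ` and `A^* c_{p,q} ∈ H^{p,q}_A` — namely
`c_{p,q} = π_χ` of the components of `c` in the Hodge decomposition of `A`
(`π_χ c = c`, `π_χ` lands in `V_χ` and preserves the `(p,q)`-classes of `A`).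
[cite: Shioda1979PJA, §4] [cite: Ran1980, §1 Prop. 1.7 (i)–(ii)] [cite: VoisinHodgeI2002, §7.3.2] -/
theorem exists_sum_eigenspace_hodgePQ_eq [Fintype G] (hG : G ≤ diagonalStabilizer F) (χ : G →* ℂˣ)
    (hX : IsSmoothProjective n (SmoothHypersurface.hypersurface F))
    (A : HodgeModel n (SmoothHypersurface.hypersurface F)) {k : ℕ}
    {c : complexBetti (SmoothHypersurface.hypersurface F) k} (hc : c ∈ diagonalCharacterEigenspace F G χ k) :
    ∃ z : ℕ × ℕ → complexBetti (SmoothHypersurface.hypersurface F) k,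
      (∑ i ∈ antidiagonal k, z i) = c ∧ ∀ i ∈ antidiagonal k,
        z i ∈ diagonalCharacterEigenspace F G χ k ∧ A.pullback k (z i) ∈ A.hodgePQ k i.1 i.2 := by
  obtain ⟨z, hz, hzA⟩ := A.exists_sum_eq_of_hodgeDecomposition k c
  refine ⟨fun i ↦ eigenProjector F χ k hG (z i), ?_, fun i hi ↦
    ⟨eigenProjector_mem F hG (z i), A.pullback_eigenProjector_mem_hodgePQ F hG χ hX (hzA i hi)⟩⟩
  rw [← map_sum, hz]
  exact eigenProjector_apply_of_mem F hG hc

/-- **Criterion for the Hodge type of an eigenspace**: if `V_χ ⊆ Hᵏ(X_F(ℂ); ℂ)` contains no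
non-zero class of any type `(p,q)`, `p + q = k`, `(p,q) ≠ (p₀,q₀)` (read in the Hodge model `A`),
then every class of `V_χ` is of type `(p₀,q₀)` in `A`. [cite: Shioda1979PJA, §4]
[cite: Ran1980, §1 Prop. 1.7 (ii)] -/
theorem pullback_mem_hodgePQ_of_eigenspace [Fintype G] (hG : G ≤ diagonalStabilizer F) (χ : G →* ℂˣ)
    (hX : IsSmoothProjective n (SmoothHypersurface.hypersurface F))
    (A : HodgeModel n (SmoothHypersurface.hypersurface F)) {k p₀ q₀ : ℕ}
    (h : ∀ i ∈ antidiagonal k, i ≠ (p₀, q₀) → ∀ x ∈ diagonalCharacterEigenspace F G χ k,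
      A.pullback k x ∈ A.hodgePQ k i.1 i.2 → x = 0)
    {c : complexBetti (SmoothHypersurface.hypersurface F) k} (hc : c ∈ diagonalCharacterEigenspace F G χ k) :
    A.pullback k c ∈ A.hodgePQ k p₀ q₀ := by
  classical
  obtain ⟨z, hz, hzA⟩ := exists_sum_eigenspace_hodgePQ_eq F hG χ hX A hc
  by_cases hpq : (p₀, q₀) ∈ antidiagonal k
  · have hcz : c = z (p₀, q₀) := by
      rw [← hz, Finset.sum_eq_single (p₀, q₀)]
      · exact fun i hi hne ↦ h i hi hne _ (hzA i hi).1 (hzA i hi).2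
      · exact fun hn ↦ absurd hpq hn
    rw [hcz]
    exact (hzA _ hpq).2
  · have hc0 : c = 0 := by
      rw [← hz]
      exact Finset.sum_eq_zero fun i hi ↦ h i hi (fun he ↦ hpq (he ▸ hi)) _ (hzA i hi).1 (hzA i hi).2
    rw [hc0, map_zero]
    exact Submodule.zero_mem _

/-! ### Complex conjugation -/

/-- The values of a character of a finite group are roots of unity, so `conj χ(a) = χ(a)⁻¹`.
[cite: SerreLinearRepresentations1977, §2.1 Prop. 1] -/
theorem starRingEnd_monoidHom_apply [Fintype G] (χ : G →* ℂˣ) (a : G) :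
    starRingEnd ℂ ((χ a : ℂˣ) : ℂ) = ((χ a : ℂˣ) : ℂ)⁻¹ := by
  have hpow : ((χ a : ℂˣ) : ℂ) ^ Fintype.card G = 1 := by
    rw [← Units.val_pow_eq_pow_val, ← map_pow, pow_card_eq_one, map_one, Units.val_one]
  have hnorm : ‖((χ a : ℂˣ) : ℂ)‖ = 1 := Complex.norm_eq_one_of_pow_eq_one hpow Fintype.card_ne_zero
  rw [Complex.inv_def, Complex.normSq_eq_norm_sq, hnorm]
  simp

/-- **`conj V_χ ⊆ V_{χ⁻¹}`** (Ran Prop. 1.7 (iii); Shioda (1.7) `conj V(α) = V(-α)`): complex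
conjugation of `Hᵏ(X_F(ℂ); ℂ)` commutes with the `g_a^*` (`conjClass_map`) and is conjugate-linear,
and `conj χ(a) = χ(a)⁻¹`. [cite: Ran1980, §1 Prop. 1.7 (iii)] [cite: Shioda1979HodgeFermat, §1 (1.7)] -/
theorem conjClass_mem_diagonalCharacterEigenspace [Fintype G] (hG : G ≤ diagonalStabilizer F) (χ : G →* ℂˣ)
    {k : ℕ} {c : complexBetti (SmoothHypersurface.hypersurface F) k}
    (hc : c ∈ diagonalCharacterEigenspace F G χ k) :
    conjClass (ComplexPoints (SmoothHypersurface.hypersurface F)) k c ∈ diagonalCharacterEigenspace F G χ⁻¹ k := by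
  rw [mem_diagonalCharacterEigenspace_iff_diagonalMap hG] at hc ⊢
  intro a
  rw [← conjClass_map, hc a, conjClass_smul, starRingEnd_monoidHom_apply, MonoidHom.inv_apply,
    Units.val_inv_eq_inv_val]

/-- **No `(q,p)`-classes in `V_χ` if no `(p,q)`-classes in `V_{χ⁻¹}`**: for `X_F` smooth projective
with Hodge model `A` (Hodge symmetric: `conj H^{q,p}_A ⊆ H^{p,q}_A`, Voisin I Cor. 6.12), if every
`x ∈ V_{χ⁻¹}` with `A^* x ∈ H^{p,q}_A` vanishes, then so does every `x ∈ V_χ` with `A^* x ∈ H^{q,p}_A`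
(apply the hypothesis to `conj x`). [cite: Ran1980, §1 Prop. 1.7 (ii)–(iii)] [cite: VoisinHodgeI2002, §6.1.3 Cor. 6.12] -/
theorem eigenspace_eq_zero_of_hodgePQ_swap [Fintype G] (hG : G ≤ diagonalStabilizer F) (χ : G →* ℂˣ)
    (hX : IsSmoothProjective n (SmoothHypersurface.hypersurface F))
    (A : HodgeModel n (SmoothHypersurface.hypersurface F)) {k p q : ℕ}
    (h : ∀ x ∈ diagonalCharacterEigenspace F G χ⁻¹ k, A.pullback k x ∈ A.hodgePQ k p q → x = 0)
    {x : complexBetti (SmoothHypersurface.hypersurface F) k} (hx : x ∈ diagonalCharacterEigenspace F G χ k)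
    (hxA : A.pullback k x ∈ A.hodgePQ k q p) : x = 0 := by
  have h1 := conjClass_mem_diagonalCharacterEigenspace F hG χ hx
  have h2 : A.pullback k (conjClass (ComplexPoints (SmoothHypersurface.hypersurface F)) k x) ∈ A.hodgePQ k p q := by
    rw [A.pullback_conjClass]
    exact A.isHodgeSymmetric hX k q p _ hxA
  rw [← conjClass_conjClass x, h _ h1 h2, conjClass_zero]

/-- **Type `(p,p)` from the vanishing of the `(p',q')`-parts with `q' < p'`**: in even degree
`k = 2p`, if neither `V_χ` nor `V_{χ⁻¹}` contains a non-zero class of a type `(p',q')` with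
`p' + q' = 2p`, `q' < p'`, then every class of `V_χ` is of type `(p,p)` (the types with `p' < q'`
are excluded by conjugation, `eigenspace_eq_zero_of_hodgePQ_swap`). [cite: Ran1980, §1 Prop. 1.7 (ii)–(iii)]
[cite: Shioda1979PJA, §4] -/
theorem pullback_mem_hodgePQ_half_of_eigenspace [Fintype G] (hG : G ≤ diagonalStabilizer F) (χ : G →* ℂˣ)
    (hX : IsSmoothProjective n (SmoothHypersurface.hypersurface F))
    (A : HodgeModel n (SmoothHypersurface.hypersurface F)) {p : ℕ}
    (h₁ : ∀ i ∈ antidiagonal (2 * p), i.2 < i.1 → ∀ x ∈ diagonalCharacterEigenspace F G χ (2 * p),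
      A.pullback (2 * p) x ∈ A.hodgePQ (2 * p) i.1 i.2 → x = 0)
    (h₂ : ∀ i ∈ antidiagonal (2 * p), i.2 < i.1 → ∀ x ∈ diagonalCharacterEigenspace F G χ⁻¹ (2 * p),
      A.pullback (2 * p) x ∈ A.hodgePQ (2 * p) i.1 i.2 → x = 0)
    {c : complexBetti (SmoothHypersurface.hypersurface F) (2 * p)} (hc : c ∈ diagonalCharacterEigenspace F G χ (2 * p)) :
    A.pullback (2 * p) c ∈ A.hodgePQ (2 * p) p p := by
  refine pullback_mem_hodgePQ_of_eigenspace F hG χ hX A (fun i hi hne x hx hxA ↦ ?_) hc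
  obtain ⟨p', q'⟩ := i
  have hsum : p' + q' = 2 * p := Finset.HasAntidiagonal.mem_antidiagonal.mp hi
  rcases lt_trichotomy q' p' with hlt | heq | hgt
  · exact h₁ (p', q') hi hlt x hx hxA
  · exact absurd (Prod.ext (show p' = p by omega) (show q' = p by omega)) hne
  · exact eigenspace_eq_zero_of_hodgePQ_swap F hG χ hX A
      (h₂ (q', p') (Finset.HasAntidiagonal.mem_antidiagonal.mpr (show q' + p' = 2 * p by omega)) hgt) hx hxA

end Diagonal

/-! ### The Fermat variety: `conj V(α) ⊆ V(-α)` -/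

section Fermat

variable {n m : ℕ}

/-- **`χ_{-α} = χ_α⁻¹`**: `aᵢ^{⟨-αᵢ⟩} aᵢ^{⟨αᵢ⟩} = aᵢ^{0 or m} = 1` on `μₘⁿ⁺²`.
[cite: Shioda1979HodgeFermat, §1 (1.7)] -/
theorem fermatCharacter_neg [NeZero m] (α : Fin (n + 2) → ZMod m) :
    fermatCharacter m (-α) = (fermatCharacter m α)⁻¹ := by
  ext a : 1
  rw [MonoidHom.inv_apply, eq_inv_iff_mul_eq_one, fermatCharacter_apply, fermatCharacter_apply,
    ← Finset.prod_mul_distrib]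
  refine Finset.prod_eq_one fun i _ ↦ ?_
  have hai : (a : Fin (n + 2) → ℂˣ) i ^ m = 1 := mem_fermatGroup_iff.mp a.2 i
  rw [← pow_add, Pi.neg_apply, ZMod.neg_val]
  split_ifs with h0
  · rw [h0, ZMod.val_zero, add_zero, pow_zero]
  · rw [Nat.sub_add_cancel (ZMod.val_lt (α i)).le, hai]

/-- **`conj V(α) ⊆ V(-α)`** on `Hᵏ(Xⁿₘ(ℂ); ℂ)` (Shioda (1.7): "`conj V(α) = V(-α)`"; Ran Prop. 1.7
(iii)). [cite: Shioda1979HodgeFermat, §1 (1.7)] [cite: Ran1980, §1 Prop. 1.7 (iii)] -/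
theorem conjClass_mem_fermatEigenspace [NeZero m] {α : Fin (n + 2) → ZMod m} {k : ℕ}
    {c : complexBetti (fermatHypersurface n m) k} (hc : c ∈ fermatEigenspace m α k) :
    conjClass (ComplexPoints (fermatHypersurface n m)) k c ∈ fermatEigenspace m (-α) k := by
  rw [fermatEigenspace, fermatCharacter_neg]
  exact conjClass_mem_diagonalCharacterEigenspace _ (fermatGroup_le_diagonalStabilizer m) _ hc

/-- **No `(q,p)`-classes in `V(α)` if no `(p,q)`-classes in `V(-α)`** (`Xⁿₘ`, `n ≥ 1`, `m ≥ 1`, any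
Hodge model `A`). [cite: Ran1980, §1 Prop. 1.7 (ii)–(iii)] [cite: VoisinHodgeI2002, §6.1.3 Cor. 6.12] -/
theorem fermatEigenspace_eq_zero_of_hodgePQ_swap [NeZero m] (hn : 1 ≤ n) (A : HodgeModel n (fermatHypersurface n m))
    {α : Fin (n + 2) → ZMod m} {k p q : ℕ}
    (h : ∀ x ∈ fermatEigenspace m (-α) k, A.pullback k x ∈ A.hodgePQ k p q → x = 0)
    {x : complexBetti (fermatHypersurface n m) k} (hx : x ∈ fermatEigenspace m α k)
    (hxA : A.pullback k x ∈ A.hodgePQ k q p) : x = 0 := by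
  have hX : IsSmoothProjective n (fermatHypersurface n m) :=
    isSmoothProjective_fermatHypersurface hn NeZero.one_le
  refine eigenspace_eq_zero_of_hodgePQ_swap _ (fermatGroup_le_diagonalStabilizer m) _ hX A ?_ hx hxA
  rw [← fermatCharacter_neg]
  exact h

/-! ### The Fermat surface: `V(β) ⊆ H^{1,1}` from the vanishing of the `(2,0)`-parts of `V(±β)` -/

/-- **Hodge type `(1,1)` of an eigenline of the Fermat surface from the `(2,0)`-parts**: for
`m ≥ 1`, a Hodge model `A` of `X²ₘ = V₊(Σᵢ₌₀³ xᵢᵐ) ⊂ ℙ³` and a character `β`, if neither `V(β)` nor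
`V(-β)` contains a non-zero class `x` with `A^* x ∈ H^{2,0}_A`, then `A^* V(β) ⊆ H^{1,1}_A`
(the `(0,2)`-part of `V(β)` is the conjugate of the `(2,0)`-part of `V(-β)`). This is the formal
half of Shioda (1.7) / Ran Prop. 1.7 (ii) for `n = 2`; the analytic half is the determination of
the `(2,0)`-part (holomorphic `2`-forms = residues). [cite: Shioda1979HodgeFermat, §1 (1.7)]
[cite: Ran1980, §1 Prop. 1.7 (ii)–(iii)] -/
theorem fermatEigenspace_two_mem_hodgePQ_one_one [NeZero m] (A : HodgeModel 2 (fermatHypersurface 2 m))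
    {β : Fin 4 → ZMod m}
    (h₁ : ∀ x ∈ fermatEigenspace m β 2, A.pullback 2 x ∈ A.hodgePQ 2 2 0 → x = 0)
    (h₂ : ∀ x ∈ fermatEigenspace m (-β) 2, A.pullback 2 x ∈ A.hodgePQ 2 2 0 → x = 0)
    {x : complexBetti (fermatHypersurface 2 m) 2} (hx : x ∈ fermatEigenspace m β 2) :
    A.pullback 2 x ∈ A.hodgePQ 2 1 1 := by
  have hX : IsSmoothProjective 2 (fermatHypersurface 2 m) :=
    isSmoothProjective_fermatHypersurface (by norm_num) NeZero.one_le
  have h20 : ∀ i ∈ antidiagonal (2 * 1), i.2 < i.1 → i = (2, 0) := by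
    rintro ⟨p', q'⟩ hi hlt
    have hsum : p' + q' = 2 * 1 := Finset.HasAntidiagonal.mem_antidiagonal.mp hi
    change q' < p' at hlt
    exact Prod.ext (show p' = 2 by omega) (show q' = 0 by omega)
  refine pullback_mem_hodgePQ_half_of_eigenspace (p := 1) _ (fermatGroup_le_diagonalStabilizer m) _ hX A
    (fun i hi hlt y hy hyA ↦ ?_) (fun i hi hlt y hy hyA ↦ ?_) hx
  · obtain rfl := h20 i hi hlt
    exact h₁ y hy hyA
  · obtain rfl := h20 i hi hlt
    rw [← fermatCharacter_neg] at hy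
    exact h₂ y hy hyA

/-- The same in the `∃`-model spelling `IsOfHodgeType` (all Hodge models of the smooth projective
`X²ₘ` cut out the same `H^{p,q}`, `isOfHodgeType_iff_mem_hodgePQ`): if no non-zero class of
`V(β) ∪ V(-β)` is of Hodge type `(2,0)`, then every class of `V(β)` is of Hodge type `(1,1)`.
[cite: Shioda1979HodgeFermat, §1 (1.7)] [cite: Ran1980, §1 Prop. 1.7 (ii)–(iii)] -/
theorem isOfHodgeType_one_one_of_mem_fermatEigenspace_two [NeZero m] {β : Fin 4 → ZMod m}
    (h₁ : ∀ x ∈ fermatEigenspace m β 2, IsOfHodgeType 2 (fermatHypersurface 2 m) 2 2 0 x → x = 0)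
    (h₂ : ∀ x ∈ fermatEigenspace m (-β) 2, IsOfHodgeType 2 (fermatHypersurface 2 m) 2 2 0 x → x = 0)
    {x : complexBetti (fermatHypersurface 2 m) 2} (hx : x ∈ fermatEigenspace m β 2) :
    IsOfHodgeType 2 (fermatHypersurface 2 m) 2 1 1 x := by
  have hX : IsSmoothProjective 2 (fermatHypersurface 2 m) :=
    isSmoothProjective_fermatHypersurface (by norm_num) NeZero.one_le
  obtain ⟨A⟩ := nonempty_hodgeModel_holds hX
  exact ⟨A, fermatEigenspace_two_mem_hodgePQ_one_one A (fun y hy hyA ↦ h₁ y hy ⟨A, hyA⟩)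
    (fun y hy hyA ↦ h₂ y hy ⟨A, hyA⟩) hx⟩

end Fermat

/-! ### The named fact from Lefschetz `(1,1)` and the vanishing of the `(2,0)`-parts of the Hodge eigenlines -/

section Surface

/-- **Hypothesis (H) of `AokiShioda1983_eigenline_le_neronSeveri_of_lefschetzOneOne` from its
`(2,0)`-part**: if for every `m ≥ 1` and every `β ∈ 𝔅²ₘ` no non-zero class of `V(β)` is of Hodge
type `(2,0)`, then for every `m ≥ 1` some (indeed every) Hodge model `A` of `X²ₘ` has
`A^* V(β) ⊆ H^{1,1}_A` for all `β ∈ 𝔅²ₘ` (`𝔅²ₘ` is stable under `β ↦ -β`,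
`FermatCharacter.IsHodge.neg`; Hodge models exist, `nonempty_hodgeModel_holds`).
[cite: Shioda1979HodgeFermat, §1 (1.7) and Thm. I] [cite: Ran1980, §1 Prop. 1.7 (ii)–(iii)] -/
theorem fermatSurface_hodgeEigenlines_oneOne_of_twoZero
    (h20 : ∀ (m : ℕ) [NeZero m] (β : Fin 4 → ZMod m), FermatCharacter.IsHodge β →
      ∀ x ∈ fermatEigenspace m β 2, IsOfHodgeType 2 (fermatHypersurface 2 m) 2 2 0 x → x = 0)
    (m : ℕ) [NeZero m] :
    ∃ A : HodgeModel 2 (fermatHypersurface 2 m), ∀ β : Fin 4 → ZMod m, FermatCharacter.IsHodge β →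
      ∀ x ∈ fermatEigenspace m β 2, A.pullback 2 x ∈ A.hodgePQ 2 1 1 := by
  have hX : IsSmoothProjective 2 (fermatHypersurface 2 m) :=
    isSmoothProjective_fermatHypersurface (by norm_num) NeZero.one_le
  obtain ⟨A⟩ := nonempty_hodgeModel_holds hX
  exact ⟨A, fun β hβ x hx ↦ fermatEigenspace_two_mem_hodgePQ_one_one A
    (fun y hy hyA ↦ h20 m β hβ y hy ⟨A, hyA⟩) (fun y hy hyA ↦ h20 m (-β) hβ.neg y hy ⟨A, hyA⟩) hx⟩

/-- **`AokiShioda1983_eigenline_le_neronSeveri` from Lefschetz `(1,1)` (L) and the vanishing of the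
`(2,0)`-parts of the Hodge eigenlines (H₂₀).** The printed proof of Aoki–Shioda `(2.1)` ("[3, Thm. I]"
+ the Lefschetz criterion) with Shioda's Thm. I entering only through its `(2,0)`-clause for the
surface: for `β ∈ 𝔅²ₘ` (`|β| = 2`) the eigenline `V(β)` has no `(2,0)`-part — the holomorphic
`2`-forms `Res(x^a Ω/F)` of `X²ₘ` have characters of length `1`. Glue: `FermatSurfaceNeronSeveriEigenlinesProofs`
(`ℚ`-structure, orbit projector) and this file (Hodge decomposition vs. characters, conjugation).
[cite: AokiShioda1983, §2 (2.1)–(2.2), p. 3] [cite: Shioda1979HodgeFermat, §1 (1.7) and Thm. I]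
[cite: VoisinHodgeI2002, Thm. 11.30 and §11.3.3] -/
theorem AokiShioda1983_eigenline_le_neronSeveri_of_lefschetzOneOne_of_twoZero
    (hL : lefschetzOneOne_rational)
    (h20 : ∀ (m : ℕ) [NeZero m] (β : Fin 4 → ZMod m), FermatCharacter.IsHodge β →
      ∀ x ∈ fermatEigenspace m β 2, IsOfHodgeType 2 (fermatHypersurface 2 m) 2 2 0 x → x = 0) :
    AokiShioda1983_eigenline_le_neronSeveri :=
  AokiShioda1983_eigenline_le_neronSeveri_of_lefschetzOneOne hL
    fun m _ ↦ fermatSurface_hodgeEigenlines_oneOne_of_twoZero h20 m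

/-- Single-`m` version: `V(α) ⊆ N¹H²(X²ₘ(ℂ); ℂ)` for `α ∈ 𝔅²ₘ` from Lefschetz `(1,1)` for the surface
`X²ₘ` alone and the vanishing of the `(2,0)`-parts of the `V(β)`, `β ∈ 𝔅²ₘ`, at this `m`.
[cite: AokiShioda1983, §2 (2.1)–(2.2), p. 3] [cite: VoisinHodgeI2002, Thm. 11.30 and §11.3.3] -/
theorem fermatEigenspace_le_algebraicClasses_surface_of_twoZero {m : ℕ} [NeZero m]
    (hL : ∀ c : complexBetti (fermatHypersurface 2 m) 2, IsRationalClass c →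
      IsOfHodgeType 2 (fermatHypersurface 2 m) 2 1 1 c → c ∈ algebraicClasses (fermatHypersurface 2 m) 1)
    (h20 : ∀ β : Fin 4 → ZMod m, FermatCharacter.IsHodge β →
      ∀ x ∈ fermatEigenspace m β 2, IsOfHodgeType 2 (fermatHypersurface 2 m) 2 2 0 x → x = 0)
    {α : Fin 4 → ZMod m} (hα : FermatCharacter.IsHodge α) :
    fermatEigenspace m α 2 ≤ algebraicClasses (fermatHypersurface 2 m) 1 := by
  have hX : IsSmoothProjective 2 (fermatHypersurface 2 m) :=
    isSmoothProjective_fermatHypersurface (by norm_num) NeZero.one_le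
  obtain ⟨A⟩ := nonempty_hodgeModel_holds hX
  refine fermatEigenspace_le_algebraicClasses_surface_of hL ⟨A, fun β hβ x hx ↦ ?_⟩ hα
  exact fermatEigenspace_two_mem_hodgePQ_one_one A (fun y hy hyA ↦ h20 β hβ y hy ⟨A, hyA⟩)
    (fun y hy hyA ↦ h20 (-β) hβ.neg y hy ⟨A, hyA⟩) hx

end Surface

/-! ### The `(n,0)`-part of an eigenspace and the holomorphic eigenforms of top degree -/

section Forms

variable {n : ℕ} (F : MvPolynomial (Fin (n + 2)) ℂ) {G : Subgroup (Fin (n + 2) → ℂˣ)}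

/-- **An `(n,0)`-class which is an eigenvector of an endomorphism is the class of an EIGENFORM.**
For `X_F` smooth projective of dimension `n` with Hodge model `A`, an endomorphism `g : X_F ⟶ X_F`
(acting on the carrier `X^an` by the holomorphic map `g^an = HodgeModel.anMap A A g`, Serre GAGA
§2 n°5), a class `x ∈ Hⁿ(X_F(ℂ); ℂ)` with `g^* x = t x`, and a closed `(n,0)`-form `η` on `X^an` with
`e[η] = A^* x` (`e = A.deRham`): then `(g^an)^* η = t η` AS FORMS. Indeed
`e[(g^an)^* η] = (g^an)^* e[η] = A^*(g^* x) = t e[η] = e[t η]` (naturality of `e`,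
`HodgeModel.map_anMap_pullback`), so the closed `(n,0)`-form `(g^an)^* η - t η` is exact, hence
zero: a non-zero closed `(n,0)`-form on a compact complex `n`-fold is not exact
(`closedForm_top_zero_not_exact`, `∫ ζ ∧ ζ̄ ≠ 0`). [cite: VoisinHodgeI2002, Prop. 7.5, Cor. 7.6 and §7.3.2]
[cite: SerreGAGA1956, §2 n°5 (fonctorialité de X^h)] -/
theorem pullback_anMap_eq_smul_of_eigenclass {X : Motives.SchemeOver ℂ} (hX : IsSmoothProjective n X)
    (A : HodgeModel n X) (g : X ⟶ X) (t : ℂ) {x : complexBetti X n}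
    (hxg : singularCohomology.map ℂ ℂ (Motives.AlgPoints.mapContinuous (L := ℂ) g) n x = t • x)
    (η : cclosedSmoothForms A.model A.carrier n)
    (hηt : IsOfType n 0 (η : Literature.Geometry.Kaehler.MForm 𝓘(ℝ, A.model) A.carrier ℂ n))
    (hwx : A.deRham A.carrier n (complexDeRhamCohomology.mk A.model A.carrier n η) = A.pullback n x) :
    (η : Literature.Geometry.Kaehler.MForm 𝓘(ℝ, A.model) A.carrier ℂ n).pullback 𝓘(ℝ, A.model) (HodgeModel.anMap A A g) =
      t • (η : Literature.Geometry.Kaehler.MForm 𝓘(ℝ, A.model) A.carrier ℂ n) := by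
  haveI : CompactSpace A.carrier := A.compactSpace_carrier hX
  have hgs : ContMDiff 𝓘(ℝ, A.model) 𝓘(ℝ, A.model) ∞ (HodgeModel.anMap A A g) :=
    HodgeModel.contMDiff_anMap A A g hX hX
  have hgh : MDifferentiable 𝓘(ℂ, A.model) 𝓘(ℂ, A.model) (HodgeModel.anMap A A g) :=
    HodgeModel.mdifferentiable_anMap A A g hX hX
  -- naturality of `e` and the eigen-equation: `e (mk (g^* η)) = e (mk (t • η))`
  have hnat := A.deRham_isNatural A.carrier A.carrier (HodgeModel.anMap A A g) hgs n
    (complexDeRhamCohomology.mk A.model A.carrier n η)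
  have hcont : (⟨HodgeModel.anMap A A g, hgs.continuous⟩ : C(A.carrier, A.carrier)) =
      ⟨HodgeModel.anMap A A g, HodgeModel.continuous_anMap A A g⟩ := rfl
  rw [hcont, hwx, HodgeModel.map_anMap_pullback, hxg, map_smul, ← hwx, ← map_smul,
    complexDeRhamCohomology.map_mk] at hnat
  have hmk := (A.deRham A.carrier n).injective hnat
  -- so the closed `(n,0)`-form `g^* η - t • η` is exact …
  have hζex : (η : Literature.Geometry.Kaehler.MForm 𝓘(ℝ, A.model) A.carrier ℂ n).pullback 𝓘(ℝ, A.model)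
      (HodgeModel.anMap A A g) - t • (η : Literature.Geometry.Kaehler.MForm 𝓘(ℝ, A.model) A.carrier ℂ n) ∈
        cexactSmoothForms A.model A.carrier n :=
    (complexDeRhamCohomology.mk_eq_mk_iff _ _).1 hmk
  have hζmem : (η : Literature.Geometry.Kaehler.MForm 𝓘(ℝ, A.model) A.carrier ℂ n).pullback 𝓘(ℝ, A.model)
      (HodgeModel.anMap A A g) - t • (η : Literature.Geometry.Kaehler.MForm 𝓘(ℝ, A.model) A.carrier ℂ n) ∈
        cclosedSmoothForms A.model A.carrier n :=
    Submodule.sub_mem _ (pullback_mem_cclosedSmoothForms hgs η.2) (Submodule.smul_mem _ _ η.2)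
  obtain ⟨hζs, hζc⟩ := (mem_cclosedSmoothForms_iff _).1 hζmem
  have hζt : IsOfType n 0 ((η : Literature.Geometry.Kaehler.MForm 𝓘(ℝ, A.model) A.carrier ℂ n).pullback 𝓘(ℝ, A.model)
      (HodgeModel.anMap A A g) - t • (η : Literature.Geometry.Kaehler.MForm 𝓘(ℝ, A.model) A.carrier ℂ n)) := by
    rw [sub_eq_add_neg]
    exact (hηt.pullback hgh).add (hηt.smul _).neg
  -- … hence zero
  have hζ0 : (η : Literature.Geometry.Kaehler.MForm 𝓘(ℝ, A.model) A.carrier ℂ n).pullback 𝓘(ℝ, A.model)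
      (HodgeModel.anMap A A g) - t • (η : Literature.Geometry.Kaehler.MForm 𝓘(ℝ, A.model) A.carrier ℂ n) = 0 := by
    by_contra hne
    exact closedForm_top_zero_not_exact n A.isAnalytification.finrank_eq _ hζs hζc hζt hne hζex
  exact sub_eq_zero.1 hζ0

/-- **The `(n,0)`-classes of `V_χ` are the classes of the `χ`-eigen holomorphic `n`-forms; so `V_χ`
has no non-zero `(n,0)`-class if `X_F^an` has no non-zero `χ`-eigen closed `(n,0)`-form.** For
`X_F` smooth projective of dimension `n` with Hodge model `A` (carrier `X^an`, a compact complex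
`n`-fold on which the `g_a` act by the holomorphic maps `g_a^an = HodgeModel.anMap A A (diagonalAut F _)`,
Serre GAGA §2 n°5): if every smooth closed `n`-form `η` of type `(n,0)` on `X^an` with
`(g_a^an)^* η = χ(a) η` for all `a ∈ G` vanishes, then every `x ∈ V_χ ⊆ Hⁿ(X_F(ℂ); ℂ)` with
`A^* x ∈ H^{n,0}_A` is zero: `A^* x = e[η]` for one closed `(n,0)`-form `η`
(`Motives.exists_isOfType_mk_eq_of_mem_hodgePQ`), which is a `χ`-eigenform by
`pullback_anMap_eq_smul_of_eigenclass`,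
hence `η = 0` and `x = 0`. [cite: Shioda1979PJA, §4] [cite: Ran1980, §1 Prop. 1.7 (ii)]
[cite: VoisinHodgeI2002, Prop. 7.5, Cor. 7.6 and §7.3.2] -/
theorem eigenspace_hodgePQ_top_zero_eq_zero_of_eigenforms (hG : G ≤ diagonalStabilizer F) (χ : G →* ℂˣ)
    (hX : IsSmoothProjective n (SmoothHypersurface.hypersurface F))
    (A : HodgeModel n (SmoothHypersurface.hypersurface F))
    (hforms : ∀ η : Literature.Geometry.Kaehler.MForm 𝓘(ℝ, A.model) A.carrier ℂ n,
      Literature.Geometry.Kaehler.IsSmoothForm η → Literature.Geometry.Kaehler.IsClosedForm η → IsOfType n 0 η →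
      (∀ a : G, η.pullback 𝓘(ℝ, A.model) (HodgeModel.anMap A A (diagonalAut F (hG a.2))) = ((χ a : ℂˣ) : ℂ) • η) →
        η = 0)
    {x : complexBetti (SmoothHypersurface.hypersurface F) n} (hx : x ∈ diagonalCharacterEigenspace F G χ n)
    (hxA : A.pullback n x ∈ A.hodgePQ n n 0) : x = 0 := by
  -- `A^* x = e (mk η)` for one closed `(n,0)`-form `η`
  obtain ⟨w, hw, hwx⟩ := Submodule.mem_map.1 hxA
  rw [LinearEquiv.coe_toLinearMap] at hwx
  obtain ⟨η, hηt, rfl⟩ := exists_isOfType_mk_eq_of_mem_hodgePQ (add_zero n) hw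
  obtain ⟨hηs, hηc⟩ :=
    (mem_cclosedSmoothForms_iff (η : Literature.Geometry.Kaehler.MForm 𝓘(ℝ, A.model) A.carrier ℂ n)).1 η.2
  -- `η` is a `χ`-eigenform, hence zero
  have heigen : ∀ a : G, (η : Literature.Geometry.Kaehler.MForm 𝓘(ℝ, A.model) A.carrier ℂ n).pullback 𝓘(ℝ, A.model)
      (HodgeModel.anMap A A (diagonalAut F (hG a.2))) =
        ((χ a : ℂˣ) : ℂ) • (η : Literature.Geometry.Kaehler.MForm 𝓘(ℝ, A.model) A.carrier ℂ n) := fun a ↦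
    pullback_anMap_eq_smul_of_eigenclass hX A (diagonalAut F (hG a.2)) _
      ((mem_diagonalCharacterEigenspace_iff_diagonalMap hG).mp hx a) η hηt hwx
  have hη0 : η = 0 := Subtype.ext (hforms _ hηs hηc hηt heigen)
  apply A.pullback_injective n
  rw [← hwx, hη0, map_zero, map_zero, map_zero]

end Forms

/-! ### The Fermat surface: `(2,0)`-classes of `V(β)` and `χ_β`-eigen holomorphic `2`-forms -/

section FermatForms

variable {m : ℕ}

/-- **No `(2,0)`-classes in `V(β)` if `X²ₘ^an` has no `χ_β`-eigen holomorphic `2`-form**: for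
`m ≥ 1`, a Hodge model `A` of the Fermat surface `X²ₘ` and a character `β`, if every smooth closed
`2`-form of type `(2,0)` on `A.carrier` with `(g_a^an)^* η = χ_β(a) η` for all `a ∈ μₘ⁴` vanishes,
then every class of `V(β)` of Hodge type `(2,0)` is zero (any model computes the type,
`isOfHodgeType_iff_mem_hodgePQ`). In print: `H^{2,0}(X²ₘ) ∩ V(β) = H⁰(X²ₘ, Ω²)_{χ_β}`.
[cite: Shioda1979HodgeFermat, §1 (1.7)] [cite: Ran1980, §1 Prop. 1.7 (ii)]
[cite: VoisinHodgeI2002, Prop. 7.5, Cor. 7.6 and §7.3.2] -/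
theorem fermatEigenspace_twoZero_eq_zero_of_eigenforms [NeZero m] (A : HodgeModel 2 (fermatHypersurface 2 m))
    {β : Fin 4 → ZMod m}
    (hforms : ∀ η : Literature.Geometry.Kaehler.MForm 𝓘(ℝ, A.model) A.carrier ℂ 2,
      Literature.Geometry.Kaehler.IsSmoothForm η → Literature.Geometry.Kaehler.IsClosedForm η → IsOfType 2 0 η →
      (∀ a : fermatGroup 2 m, η.pullback 𝓘(ℝ, A.model)
        (HodgeModel.anMap A A (diagonalAut (fermatPolynomial ℂ 2 m) (fermatGroup_le_diagonalStabilizer m a.2))) =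
          ((fermatCharacter m β a : ℂˣ) : ℂ) • η) → η = 0)
    {x : complexBetti (fermatHypersurface 2 m) 2} (hx : x ∈ fermatEigenspace m β 2)
    (hxA : IsOfHodgeType 2 (fermatHypersurface 2 m) 2 2 0 x) : x = 0 := by
  have hX : IsSmoothProjective 2 (fermatHypersurface 2 m) :=
    isSmoothProjective_fermatHypersurface (by norm_num) NeZero.one_le
  exact eigenspace_hodgePQ_top_zero_eq_zero_of_eigenforms _ (fermatGroup_le_diagonalStabilizer m) _ hX A hforms hx
    ((isOfHodgeType_iff_mem_hodgePQ hX A x).1 hxA)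

/-- **`AokiShioda1983_eigenline_le_neronSeveri` from Lefschetz `(1,1)` (L) and the absence of
`χ_β`-eigen holomorphic `2`-forms for `β ∈ 𝔅²ₘ` (H₂₀, form level).** If for every `m ≥ 1` some Hodge
model `A` of `X²ₘ` has the property that for every `β ∈ 𝔅²ₘ` every smooth closed `(2,0)`-form `η` on
`A.carrier` with `(g_a^an)^* η = χ_β(a) η` (`a ∈ μₘ⁴`) vanishes — in print: the holomorphic `2`-forms
of the Fermat surface, `Res(x^a Ω/F)` with `Σ aᵢ = m - 4`, have the characters `(a₀+1, …, a₃+1)` of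
length `1`, none of length `2` (Shioda (1.7); Griffiths residues) — then, granted Lefschetz `(1,1)`,
every Hodge eigenline `V(α)`, `α ∈ 𝔅²ₘ`, lies in `NS(X²ₘ) ⊗ ℂ`.
[cite: AokiShioda1983, §2 (2.1)–(2.2), p. 3] [cite: Shioda1979HodgeFermat, §1 (1.7) and Thm. I]
[cite: VoisinHodgeI2002, Thm. 11.30 and §11.3.3] -/
theorem AokiShioda1983_eigenline_le_neronSeveri_of_lefschetzOneOne_of_eigenforms
    (hL : lefschetzOneOne_rational)
    (hforms : ∀ (m : ℕ) [NeZero m], ∃ A : HodgeModel 2 (fermatHypersurface 2 m),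
      ∀ β : Fin 4 → ZMod m, FermatCharacter.IsHodge β →
        ∀ η : Literature.Geometry.Kaehler.MForm 𝓘(ℝ, A.model) A.carrier ℂ 2,
          Literature.Geometry.Kaehler.IsSmoothForm η → Literature.Geometry.Kaehler.IsClosedForm η → IsOfType 2 0 η →
          (∀ a : fermatGroup 2 m, η.pullback 𝓘(ℝ, A.model)
            (HodgeModel.anMap A A (diagonalAut (fermatPolynomial ℂ 2 m) (fermatGroup_le_diagonalStabilizer m a.2))) =
              ((fermatCharacter m β a : ℂˣ) : ℂ) • η) → η = 0) :
    AokiShioda1983_eigenline_le_neronSeveri := by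
  refine AokiShioda1983_eigenline_le_neronSeveri_of_lefschetzOneOne_of_twoZero hL fun m _ β hβ x hx hxA ↦ ?_
  obtain ⟨A, hA⟩ := hforms m
  exact fermatEigenspace_twoZero_eq_zero_of_eigenforms A (hA β hβ) hx hxA

end FermatForms

end Literature.AlgebraicGeometry.HodgeTheory

end
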